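import Mathlib
import Summits.NavierStokesRegularity.NavierStokesRegularity.Theorems.EulerZoomLiouvillePowerGaugeEulerLiouvilleCasimirHaulBookSlices
import Summits.NavierStokesRegularity.NavierStokesRegularity.Theorems.EulerZoomLiouvillePowerGaugeEulerLiouvilleCasimirHaulRaceKit
import Summits.NavierStokesRegularity.NavierStokesRegularity.Theorems.EulerZoomLiouvillePowerGaugeEulerLiouvilleBackwardTools
import Literature.Analysis.FluidPDE.TaoEnstrophyLocalisationProofs
import Literature.Analysis.FluidPDE.KinematicApexWitness
import Literature.Analysis.FluidPDE.ClassicalSolution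
import Literature.Analysis.FluidPDE.AxisymmetricEuler
import HarnessLib

/-!
# Crux `EulerZoomLiouville.PowerGaugeEulerLiouville` (stmt-NavierStokesRegularity-19832), width sub-line `casimir_haul` (ns-idea-11, REV3),
# stub H4c `stub_haulBook` — part (c): THE HAULING BOOKKEEPING

Seat ns-sfl-p1 g10 (`--supports stmt-NavierStokesRegularity-19832 --as helper`).  The line `Cruxes/PowerGaugeEulerLiouville/Lines/casimir_haul.lean`
(REV3, sha16 31279a74fac8e2c7) states `Sig.stub_haulBook` and PROVES it in-file (ns-idea-11 g11); this file PORTS that proof to `Theorems/` with the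
line's abbreviations δ-UNFOLDED (`HaulingInequality`, `InClass`, `IsSlabBoundedSwirlFree`, `IsLedgerFlow`, `solidCyl b = {r < 2b ∧ |x₂| < b}`,
`haulShell b = {x ∈ B(0,3b) ∧ b ≤ r}`), so that the casimir MEMBER can consume it by name (it is the second input of ns-ezl-w3's
`CasimirHaul.haulRace_filler : <H4a body> → <H4c body> → <H4 body>`) and the skeleton can fill the stub by
`theorem stub_haulBook : Sig.stub_haulBook := CasimirHaul.haulBook`.

* `aemeasurable_cylDirichlet`, `cyl_dirichlet_budget` — the window Dirichlet budget of the solid cylinder (`E`-gauge at the single scale `3b`);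
* ★ `haulBook` — H4c, signature unfolded (parts (a) `…CasimirHaulBookTools`, (b) `…CasimirHaulBookSlices`; the moment budget is ns-ezl-w3's port
  `CasimirHaul.moment_budget`, the `A`-gauge slice budget is `Backward.lintegral_ball_le_of_gaugeA`).

HONEST FRAMING: bookkeeping for a width sub-line of the crux class (the kill composes H4a ∘ H4c ∘ H3; H6 is the wall); nothing here bears on the crux
E (19832 OPEN) or on NS regularity; no summit statement is proved by this file; not E. [cite: CaffarelliKohnNirenberg1982, §2 (parabolic gauges)]
-/

noncomputable section

-- flat `Theorems/<Route><Decl>…` files of one crux share the namespace of the crux (tree convention)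
set_option linter.dupNamespace false

open MeasureTheory Set Filter Topology Metric Function
open scoped NNReal ENNReal

namespace Summit.NavierStokesRegularity.NavierStokesRegularity.Theorems.PowerGaugeEulerLiouville.CasimirHaul

open Literature.Analysis Literature.Analysis.FluidPDE
open Summit.NavierStokesRegularity.NavierStokesRegularity.Theorems.PowerGaugeEulerLiouville

/-- `s ↦ ∫_{{x : EuclideanSpace ℝ (Fin 3) | cylRadius x < 2 * b ∧ |x 2| < b}} ‖∇u(s)‖²` is a.e.-measurable on a window inside `(−∞,0]`. -/
theorem aemeasurable_cylDirichlet {u : ℝ → EuclideanSpace ℝ (Fin 3) → EuclideanSpace ℝ (Fin 3)} {p : ℝ → EuclideanSpace ℝ (Fin 3) → ℝ}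
    (hcl : IsClassicalEulerSolutionOn (Set.Iio 0) 0 u p) (b : ℝ) {t₁ t₀ : ℝ} (ht₀ : t₀ ≤ 0) :
    AEMeasurable (fun s => ∫⁻ x in {x : EuclideanSpace ℝ (Fin 3) | cylRadius x < 2 * b ∧ |x 2| < b}, ENNReal.ofReal (‖fderiv ℝ (u s) x‖ ^ 2))
      (volume.restrict (Set.Ioo t₁ t₀)) := by
  have hD_cont : ContinuousOn (Function.uncurry fun t x => fderiv ℝ (u t) x) (Set.Iio (0 : ℝ) ×ˢ (Set.univ : Set (EuclideanSpace ℝ (Fin 3)))) :=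
    (hcl.smooth_velocity.fderiv_slice isOpen_Iio.uniqueDiffOn).continuousOn
  have hG_cont : ContinuousOn (Function.uncurry fun (t : ℝ) (x : EuclideanSpace ℝ (Fin 3)) => ENNReal.ofReal (‖fderiv ℝ (u t) x‖ ^ 2))
      (Set.Iio (0 : ℝ) ×ˢ (Set.univ : Set (EuclideanSpace ℝ (Fin 3)))) :=
    ENNReal.continuous_ofReal.comp_continuousOn (hD_cont.norm.pow 2)
  have hGi : AEMeasurable (Function.uncurry fun (σ : ℝ) (x : EuclideanSpace ℝ (Fin 3)) => ENNReal.ofReal (‖fderiv ℝ (u σ) x‖ ^ 2))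
      ((volume.restrict (Set.Ioo t₁ t₀)).prod (volume.restrict ({x : EuclideanSpace ℝ (Fin 3) | cylRadius x < 2 * b ∧ |x 2| < b}))) := by
    rw [Measure.prod_restrict, ← Measure.volume_eq_prod]
    exact (hG_cont.mono (Set.prod_mono (fun σ hσ => lt_of_lt_of_le hσ.2 ht₀) (Set.subset_univ _))).aemeasurable
      (measurableSet_Ioo.prod (measurableSet_solidCyl' b))
  exact hGi.lintegral_prod_right'

/-- DIRICHLET BUDGET of the solid cylinder on a window `(t₁,t₀) ⊆ (−9b²,0]`: `∫∫_{{x : EuclideanSpace ℝ (Fin 3) | cylRadius x < 2 * b ∧ |x 2| < b}} ‖∇u‖² ≤ c (3b)^{1−ρ}`. -/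
theorem cyl_dirichlet_budget {ρ : ℝ} {c : ℝ≥0} {u : ℝ → EuclideanSpace ℝ (Fin 3) → EuclideanSpace ℝ (Fin 3)} {p : ℝ → EuclideanSpace ℝ (Fin 3) → ℝ} {H : ℝ → EuclideanSpace ℝ (Fin 3) → EuclideanSpace ℝ (Fin 3) →L[ℝ] EuclideanSpace ℝ (Fin 3)}
    (hH : HasWeakSpatialGradientOn (slab (EuclideanSpace ℝ (Fin 3)) (Set.Iio 0) isOpen_Iio) u H)
    (hcl : IsClassicalEulerSolutionOn (Set.Iio 0) 0 u p) {b : ℝ} (hb : 0 < b)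
    (hE : ENNReal.ofReal ((3 * b) ^ ρ) * cknE (3 * b) (0 : ℝ × EuclideanSpace ℝ (Fin 3)) H ≤ (c : ℝ≥0∞))
    {t₁ t₀ : ℝ} (ht₁ : -(3 * b) ^ 2 ≤ t₁) (ht₀ : t₀ ≤ 0) :
    ∫⁻ s in Set.Ioo t₁ t₀, ∫⁻ x in {x : EuclideanSpace ℝ (Fin 3) | cylRadius x < 2 * b ∧ |x 2| < b}, ENNReal.ofReal (‖fderiv ℝ (u s) x‖ ^ 2) ≤
      ENNReal.ofReal ((c : ℝ) * (3 * b) ^ (1 - ρ)) := by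
  have ha : (0 : ℝ) < 3 * b := by positivity
  set B : Set (EuclideanSpace ℝ (Fin 3)) := Metric.ball (0 : EuclideanSpace ℝ (Fin 3)) (3 * b) with hBdef
  have hpt : ∀ s : ℝ, ∫⁻ x in {x : EuclideanSpace ℝ (Fin 3) | cylRadius x < 2 * b ∧ |x 2| < b}, ENNReal.ofReal (‖fderiv ℝ (u s) x‖ ^ 2) ≤
      ∫⁻ x in B, ENNReal.ofReal (frobeniusNormSq (fderiv ℝ (u s) x)) := fun s =>
    (lintegral_mono_set (solidCyl_subset_ball' hb)).trans
      (lintegral_mono fun x => ENNReal.ofReal_le_ofReal (sq_opNorm_le_frobeniusNormSq _))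
  refine (lintegral_mono fun s => hpt s).trans ?_
  have hIW : Set.Ioo t₁ t₀ ⊆ Set.Ioo (-(3 * b) ^ 2) 0 := fun σ hσ => ⟨lt_of_le_of_lt ht₁ hσ.1, lt_of_lt_of_le hσ.2 ht₀⟩
  have hD_cont : ContinuousOn (Function.uncurry fun t x => fderiv ℝ (u t) x) (Set.Iio (0 : ℝ) ×ˢ (Set.univ : Set (EuclideanSpace ℝ (Fin 3)))) :=
    (hcl.smooth_velocity.fderiv_slice isOpen_Iio.uniqueDiffOn).continuousOn
  have hG_cont : ContinuousOn (Function.uncurry fun (t : ℝ) (x : EuclideanSpace ℝ (Fin 3)) => ENNReal.ofReal (frobeniusNormSq (fderiv ℝ (u t) x)))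
      (Set.Iio (0 : ℝ) ×ˢ (Set.univ : Set (EuclideanSpace ℝ (Fin 3)))) :=
    ENNReal.continuous_ofReal.comp_continuousOn
      (ParabolicBump.continuous_frobeniusNormSq₃.comp_continuousOn hD_cont)
  have hGi : AEMeasurable (Function.uncurry fun (σ : ℝ) (x : EuclideanSpace ℝ (Fin 3)) => ENNReal.ofReal (frobeniusNormSq (fderiv ℝ (u σ) x)))
      ((volume.restrict (Set.Ioo (-(3 * b) ^ 2) 0)).prod (volume.restrict B)) := by
    rw [Measure.prod_restrict, ← Measure.volume_eq_prod]
    exact (hG_cont.mono (Set.prod_mono Set.Ioo_subset_Iio_self (Set.subset_univ _))).aemeasurable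
      (measurableSet_Ioo.prod measurableSet_ball)
  calc ∫⁻ s in Set.Ioo t₁ t₀, ∫⁻ x in B, ENNReal.ofReal (frobeniusNormSq (fderiv ℝ (u s) x))
      ≤ ∫⁻ s in Set.Ioo (-(3 * b) ^ 2) 0, ∫⁻ x in B, ENNReal.ofReal (frobeniusNormSq (fderiv ℝ (u s) x)) :=
        lintegral_mono_set hIW
    _ = ∫⁻ z in Set.Ioo (-(3 * b) ^ 2) 0 ×ˢ B, ENNReal.ofReal (frobeniusNormSq (fderiv ℝ (u z.1) z.2)) := by
        rw [lintegral_lintegral hGi, Measure.prod_restrict, ← Measure.volume_eq_prod]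
    _ ≤ ENNReal.ofReal ((c : ℝ) * (3 * b) ^ (1 - ρ)) := window_frobenius_le_single hH hcl ha hE




/-- ★ **H4c `stub_haulBook` of the line `casimir_haul`, signature unfolded** (REV3 text `Sig.stub_haulBook`, byte-identical to REV2, with
`HaulingInequality`, `InClass`, `IsSlabBoundedSwirlFree`, `IsLedgerFlow`, `solidCyl`, `haulShell` δ-unfolded; proof = ns-idea-11 g11's in-file REV3 proof,
ported: per slice `slice_majorant` (hauling inequality + Casimir FLOOR moment comparison + shell estimate with Young + AM–GM with CONSTANT parameters),
then the `E`-gauge window budgets `cyl_dirichlet_budget` / `CasimirHaul.moment_budget` (ns-ezl-w3's port) and the `A`-gauge slice budget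
`Backward.lintegral_ball_le_of_gaugeA` at the single scale `a = 3b`, and the real algebra `book_algebra` (`log b ≤ b^{ρ₁}/ρ₁`)).  On a window
`(t₁,t₀) ⊆ (−9b²,0]` of length `≤ b²`, for a member of the class in the haulable stratum with a ledger flow (FLOOR `λ r ≤ |ω|` on `X_s S`), the
time-integrated axial flux through `solidCyl b` plus the shell traffic is `≤ K (c+1) b^{1−ρ₁/2}/λ`, `ρ₁ = min ρ 1`, `K = 13C√(2+4/ρ₁) + 13(C+1)`.
Filler: `theorem stub_haulBook : Sig.stub_haulBook := CasimirHaul.haulBook`. [cite: CaffarelliKohnNirenberg1982, §2 (parabolic gauges)] -/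
theorem haulBook :
    (∃ C : ℝ, 0 < C ∧ ∀ b : ℝ, 1 ≤ b → ∀ v : EuclideanSpace ℝ (Fin 3) → EuclideanSpace ℝ (Fin 3), ContDiff ℝ 1 v →
      ∀ w : ℝ → ℝ, Measurable w → (∀ z : ℝ, |w z| ≤ 1) →
        ∀ A : Set (EuclideanSpace ℝ (Fin 3)), MeasurableSet A → A ⊆ {x : EuclideanSpace ℝ (Fin 3) | cylRadius x < 2 * b ∧ |x 2| < b} →
          |∫ x in A, w (x 2) * (v x) 2| ≤
            C * Real.sqrt (∫ x in {x : EuclideanSpace ℝ (Fin 3) | cylRadius x < 2 * b ∧ |x 2| < b}, ‖fderiv ℝ v x‖ ^ 2) *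
                Real.sqrt ((∫ x in A, cylRadius x ^ 2) * (1 + Real.log b + max 0 (Real.log (b / (∫ x in A, cylRadius x ^ 2))))) +
              C * Real.sqrt ((∫ x in A, cylRadius x ^ 2) / b ^ 2) *
                Real.sqrt (∫ x in {x : EuclideanSpace ℝ (Fin 3) | cylRadius x < 2 * b ∧ |x 2| < b}, ‖v x‖ ^ 2)) →
    ∀ ρ : ℝ, 0 < ρ → ∃ K : ℝ, 0 < K ∧
      ∀ (u : ℝ → EuclideanSpace ℝ (Fin 3) → EuclideanSpace ℝ (Fin 3)) (p : ℝ → EuclideanSpace ℝ (Fin 3) → ℝ)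
        (H : ℝ → EuclideanSpace ℝ (Fin 3) → EuclideanSpace ℝ (Fin 3) →L[ℝ] EuclideanSpace ℝ (Fin 3)) (c : ℝ≥0),
        (IsSuitableWeakSolutionOn (slab (EuclideanSpace ℝ (Fin 3)) (Set.Iio 0) isOpen_Iio) 0 0 u p ∧
            HasWeakSpatialGradientOn (slab (EuclideanSpace ℝ (Fin 3)) (Set.Iio 0) isOpen_Iio) u H ∧
            (∀ a : ℝ, 0 < a →
              ENNReal.ofReal (a ^ (2 * ρ)) * cknA a (0 : ℝ × EuclideanSpace ℝ (Fin 3)) u +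
                  ENNReal.ofReal (a ^ ρ) * cknE a (0 : ℝ × EuclideanSpace ℝ (Fin 3)) H +
                ENNReal.ofReal (a ^ (2 * ρ)) * cknD a (0 : ℝ × EuclideanSpace ℝ (Fin 3)) p ≤ (c : ℝ≥0∞))) →
        (IsClassicalEulerSolutionOn (Set.Iio 0) 0 u p ∧
            (∀ τ : ℝ, τ < 0 → IsAxisymmetric (u τ) ∧ HasNoSwirl (u τ)) ∧
            (∀ T₁ T₀ : ℝ, T₁ ≤ T₀ → T₀ < 0 → ∃ B : ℝ, ∀ τ ∈ Set.Icc T₁ T₀, ∀ x : EuclideanSpace ℝ (Fin 3), ‖u τ x‖ ≤ B)) →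
          ∀ lam : ℝ, 0 < lam → lam ≤ 1 → ∀ b : ℝ, 1 ≤ b →
            ∀ t₁ t₀ : ℝ, -(3 * b) ^ 2 ≤ t₁ → t₀ ≤ 0 → t₀ - t₁ ≤ b ^ 2 →
              ∀ (S : Set (EuclideanSpace ℝ (Fin 3))) (X : ℝ → EuclideanSpace ℝ (Fin 3) → EuclideanSpace ℝ (Fin 3)),
                (Continuous (fun q : ℝ × EuclideanSpace ℝ (Fin 3) => X q.1 q.2) ∧
                    (∀ x ∈ S, X t₀ x = x) ∧
                    (∀ s ∈ Set.Icc t₁ t₀, ∀ x ∈ S,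
                      HasDerivWithinAt (fun σ : ℝ => X σ x) (u s (X s x)) (Set.Icc t₁ t₀) s) ∧
                    (∀ s ∈ Set.Icc t₁ t₀, Set.InjOn (X s) S) ∧
                    (∀ s ∈ Set.Icc t₁ t₀, MeasurableSet (X s '' S) ∧ volume (X s '' S) = volume S) ∧
                    (∀ s ∈ Set.Icc t₁ t₀, ∀ g : EuclideanSpace ℝ (Fin 3) → ℝ≥0∞, Measurable g →
                      ∫⁻ x in X s '' S, g x = ∫⁻ x in S, g (X s x)) ∧
                    (∃ R : ℝ, ∀ s ∈ Set.Icc t₁ t₀, X s '' S ⊆ Metric.ball (0 : EuclideanSpace ℝ (Fin 3)) R) ∧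
                    (∀ s ∈ Set.Icc t₁ t₀, ∀ x ∈ S, lam * cylRadius (X s x) ≤ ‖curl (u s) (X s x)‖)) →
                ∀ w : ℝ → ℝ, Measurable w → (∀ z : ℝ, |w z| ≤ 1) →
                  (∫⁻ s in Set.Ioo t₁ t₀,
                      ‖∫ x in X s '' S ∩ {x : EuclideanSpace ℝ (Fin 3) | cylRadius x < 2 * b ∧ |x 2| < b}, w (x 2) * (u s x) 2‖ₑ) +
                      ∫⁻ s in Set.Ioo t₁ t₀,
                        ∫⁻ x in X s '' S ∩ {x : EuclideanSpace ℝ (Fin 3) |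
                            x ∈ Metric.ball (0 : EuclideanSpace ℝ (Fin 3)) (3 * b) ∧ b ≤ cylRadius x}, ‖u s x‖ₑ ≤
                    ENNReal.ofReal (K * ((c : ℝ) + 1) * b ^ (1 - min ρ 1 / 2) / lam) := by
  rintro ⟨C, hC, hHaul⟩ ρ hρ
  refine ⟨13 * C * Real.sqrt (2 + 4 / min ρ 1) + 13 * (C + 1), by positivity, ?_⟩
  intro u p H c hcls hsf lam hlam hlam1 b hb t₁ t₀ ht₁ ht₀ hlen S X hX w hw hw1
  obtain ⟨-, hH, hgauge⟩ := hcls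
  have hcl := hsf.1
  have hb0 : 0 < b := by linarith
  have ha : (0 : ℝ) < 3 * b := by positivity
  have hg := hgauge (3 * b) ha
  have hA : ENNReal.ofReal ((3 * b) ^ (2 * ρ)) * cknA (3 * b) (0 : ℝ × EuclideanSpace ℝ (Fin 3)) u ≤ (c : ℝ≥0∞) :=
    (le_self_add.trans le_self_add).trans hg
  have hE : ENNReal.ofReal ((3 * b) ^ ρ) * cknE (3 * b) (0 : ℝ × EuclideanSpace ℝ (Fin 3)) H ≤ (c : ℝ≥0∞) :=
    (le_add_self.trans le_self_add).trans hg
  obtain ⟨θ₁, θ₂, θ₃, hθ₁, hθ₂, hθ₃, halg⟩ := book_algebra (cc := (c : ℝ)) hC hρ hlam hlam1 hb c.coe_nonneg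
  have hlogb : 0 ≤ Real.log b := Real.log_nonneg hb
  set U₀ : ℝ := (c : ℝ) * (3 * b) ^ (1 - 2 * ρ) with hU₀
  have hU₀0 : 0 ≤ U₀ := by positivity
  set G : ℝ := 2 + 4 * Real.log b with hGdef
  set α : ℝ := C / 2 * θ₁ with hα
  set β : ℝ := C / 2 * (G / θ₁) + C / 2 * (θ₂ / b ^ 2) + θ₃ / (2 * b ^ 2) with hβ
  set γ : ℝ := C / 2 * (G / (θ₁ * b ^ 2)) + C / 2 * (U₀ / θ₂) + U₀ / (2 * θ₃) with hγ
  have hα0 : 0 ≤ α := by positivity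
  have hβ0 : 0 ≤ β := by positivity
  have hγ0 : 0 ≤ γ := by positivity
  set Dh : ℝ → ℝ≥0∞ := fun s => ∫⁻ x in {x : EuclideanSpace ℝ (Fin 3) | cylRadius x < 2 * b ∧ |x 2| < b}, ENNReal.ofReal (‖fderiv ℝ (u s) x‖ ^ 2) with hDh
  set mh : ℝ → ℝ≥0∞ := fun s => ∫⁻ x in X s '' S ∩ Metric.ball (0 : EuclideanSpace ℝ (Fin 3)) (3 * b), ENNReal.ofReal (cylRadius x ^ 2)
    with hmh
  -- per slice
  have hslice : ∀ s ∈ Set.Ioo t₁ t₀,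
      ‖∫ x in X s '' S ∩ {x : EuclideanSpace ℝ (Fin 3) | cylRadius x < 2 * b ∧ |x 2| < b}, w (x 2) * (u s x) 2‖ₑ + ∫⁻ x in X s '' S ∩ {x : EuclideanSpace ℝ (Fin 3) | x ∈ Metric.ball (0 : EuclideanSpace ℝ (Fin 3)) (3 * b) ∧ b ≤ cylRadius x}, ‖u s x‖ₑ ≤
        ENNReal.ofReal α * Dh s + ENNReal.ofReal β * mh s + ENNReal.ofReal γ := by
    intro s hs
    have hs0 : s < 0 := lt_of_lt_of_le hs.2 ht₀
    have hsW : s ∈ Set.Ioo (-((3 * b) ^ 2)) 0 := ⟨by linarith [hs.1], hs0⟩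
    have hUs := Backward.lintegral_ball_le_of_gaugeA ha hA hsW
    exact slice_majorant hC hHaul hb hcl (hX.2.2.2.2.1 s (Set.Ioo_subset_Icc_self hs)).1 hw hw1 hs0 hU₀0 hUs hθ₁ hθ₂ hθ₃
  -- integrate
  have hDae : AEMeasurable Dh (volume.restrict (Set.Ioo t₁ t₀)) := aemeasurable_cylDirichlet hcl b ht₀
  have hDint : ∫⁻ s in Set.Ioo t₁ t₀, Dh s ≤ ENNReal.ofReal ((c : ℝ) * (3 * b) ^ (1 - ρ)) :=
    cyl_dirichlet_budget hH hcl hb0 hE ht₁ ht₀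
  have hmint : ∫⁻ s in Set.Ioo t₁ t₀, mh s ≤
      ENNReal.ofReal (16 / lam ^ 2) * ENNReal.ofReal ((c : ℝ) * (3 * b) ^ (1 - ρ)) :=
    moment_budget hH hcl ha hE hlam ht₁ ht₀ (fun s hs => (hX.2.2.2.2.1 s hs).1) hX.2.2.2.2.2.2.2
  have hvol : volume (Set.Ioo t₁ t₀) ≤ ENNReal.ofReal (b ^ 2) := by
    rw [Real.volume_Ioo]; exact ENNReal.ofReal_le_ofReal (by linarith)
  calc (∫⁻ s in Set.Ioo t₁ t₀, ‖∫ x in X s '' S ∩ {x : EuclideanSpace ℝ (Fin 3) | cylRadius x < 2 * b ∧ |x 2| < b}, w (x 2) * (u s x) 2‖ₑ) +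
        ∫⁻ s in Set.Ioo t₁ t₀, ∫⁻ x in X s '' S ∩ {x : EuclideanSpace ℝ (Fin 3) | x ∈ Metric.ball (0 : EuclideanSpace ℝ (Fin 3)) (3 * b) ∧ b ≤ cylRadius x}, ‖u s x‖ₑ
      ≤ ∫⁻ s in Set.Ioo t₁ t₀, (‖∫ x in X s '' S ∩ {x : EuclideanSpace ℝ (Fin 3) | cylRadius x < 2 * b ∧ |x 2| < b}, w (x 2) * (u s x) 2‖ₑ +
          ∫⁻ x in X s '' S ∩ {x : EuclideanSpace ℝ (Fin 3) | x ∈ Metric.ball (0 : EuclideanSpace ℝ (Fin 3)) (3 * b) ∧ b ≤ cylRadius x}, ‖u s x‖ₑ) := le_lintegral_add _ _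
    _ ≤ ∫⁻ s in Set.Ioo t₁ t₀, (ENNReal.ofReal α * Dh s + ENNReal.ofReal β * mh s + ENNReal.ofReal γ) :=
        setLIntegral_mono' measurableSet_Ioo hslice
    _ = ENNReal.ofReal α * (∫⁻ s in Set.Ioo t₁ t₀, Dh s) + ENNReal.ofReal β * (∫⁻ s in Set.Ioo t₁ t₀, mh s) +
          ENNReal.ofReal γ * volume (Set.Ioo t₁ t₀) := by
        rw [lintegral_add_right _ measurable_const, lintegral_add_left' (hDae.const_mul _),
          lintegral_const_mul' _ _ ENNReal.ofReal_ne_top, lintegral_const_mul' _ _ ENNReal.ofReal_ne_top,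
          setLIntegral_const]
    _ ≤ ENNReal.ofReal α * ENNReal.ofReal ((c : ℝ) * (3 * b) ^ (1 - ρ)) +
          ENNReal.ofReal β * (ENNReal.ofReal (16 / lam ^ 2) * ENNReal.ofReal ((c : ℝ) * (3 * b) ^ (1 - ρ))) +
          ENNReal.ofReal γ * ENNReal.ofReal (b ^ 2) := by
        gcongr
    _ = ENNReal.ofReal (α * ((c : ℝ) * (3 * b) ^ (1 - ρ)) + β * (16 / lam ^ 2 * ((c : ℝ) * (3 * b) ^ (1 - ρ))) +
          γ * b ^ 2) := by
        rw [← ENNReal.ofReal_mul (by positivity : (0 : ℝ) ≤ 16 / lam ^ 2), ← ENNReal.ofReal_mul hα0,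
          ← ENNReal.ofReal_mul hβ0, ← ENNReal.ofReal_mul hγ0,
          ← ENNReal.ofReal_add (by positivity) (by positivity), ← ENNReal.ofReal_add (by positivity) (by positivity)]
    _ ≤ _ := ENNReal.ofReal_le_ofReal halg

end Summit.NavierStokesRegularity.NavierStokesRegularity.Theorems.PowerGaugeEulerLiouville.CasimirHaul

end
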